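import Summits.QuantumFields.BalabanUV.Beta.SecondOrderBorderCocycle
import Summits.QuantumFields.BalabanUV.Beta.VertexSandwichTransport

/-!
# `BalabanUV.Beta.SecondOrderBorderClassKit` — binder row D1, (L4): CLASS KIT FOR THE BORDER MODEL — the reflection action and the solution
# step PRESERVE the `LocStencil₂` class and block-translation covariance; `LocStencil₂` of a canonical contact from the classes of its letters
# (β sub-cell, row BETA-an2 = BINDER-OWNERS row D1 OWNER, lineage an2 gen 20, K-L2 part 3a; generic `d`, blocking `N ≥ 1`)

HONEST FRAMING (cell charter, verbatim): «discharging BetaPertH makes Balaban's UV stability UNCONDITIONAL — a real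
constructive-QFT result; it is NOT the continuum limit and NOT the Clay problem.»  Neutral kernel bookkeeping ([folklore]); no statement
of Bałaban's papers, no `[cite:]`, no `Prop` fact; instantiates no binder of the wall.  NOT D1, NOT `BetaPertH`, NOT continuum, NOT Clay.

WHAT.  The END's border-table hypotheses besides the letter are `hB : ∃ C δ, 0 < δ ∧ LocStencil₂ vh₂S C δ` and the block translation `hBt`.
For the model `vh₂SModel` (`SecondOrderBorderModel`) both follow from the same properties of the border contacts once the two
constructors `actB` and `stepB` are shown to preserve them:
* §1 geometry of the leg maps (`VertexSandwichTransport.l1_sref_bref_sub_le` by name): `l1_sub_le_l1_bref_sub_bref`, `mref_add`, `Φ_r_add`, `refK_shiftK` (relabelling a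
  kernel shifted by the REFLECTED vector = shifting the relabelled kernel).
* §2 `locStencil₂_actB`, `locStencil₂_stepB`, `locStencil₂_bdB`: the class `LocStencil₂` is preserved (constants explicit, rate kept).
* §3 `translate_actB`, `translate_stepB`, `translate_bdB`: block-translation covariance is preserved.
* §4 `biLoc_comp_far_left/_right`: a product of a table localised at `u′` with one localised at `u` is localised at `u` with a constant
  decaying in `|u′ − u|`; **`locStencil₂_conjW`**: the canonical contact family `conjW 𝕄 (S κ u) (S κ′ u′) (X κ u) (X κ′ u′) (X₂ κ u κ′ u′)`
  is `LocStencil₂` when `S`, `X` are local stencil families, `𝕄` decays and `X₂` is `LocStencil₂` (all at one rate `δ > 0`; result at rate `δ/8`).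
Provenance: β sub-cell, unit beta-an2 gen 20, 2026-08-20 (v1); no existing file touched.
-/

open Finset
open scoped BigOperators
open Literature.MathematicalPhysics.QuantumFieldTheory
open Literature.MathematicalPhysics.QuantumFieldTheory.Balaban1983to89
open Literature.MathematicalPhysics.QuantumFieldTheory.Balaban1983to89.Beta
open B12Sec2to5 (l1 l1_nonneg)
open ExpKernelCalculus (MKer Decays BiLoc comp shiftK Zl Zl_pos biLoc_comp_biLoc biLoc_comp_decays l1_sub_triangle)
open PolarizationSign (reflSign axisReflect axisReflect_apply)
open KernelReflection (LegMap refK refK_apply)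
open KernelWard (biLoc_add biLoc_sub biLoc_recentre)
open StepJetData (biLoc_weaken biLoc_smul)
open OneStepResolventKernel (Fib LocStencil biLoc_mono decays_mono)
open BalabanStepJetsSucc (biLoc_comp_right)
open SecondOrderResponse (biLoc_recenter_left biLoc_recenter_right)
open BalabanCompositeJets (LocStencil₂)
open BalabanStepW2 (locStencil₂_add' locStencil₂_smul')
open ResolventReflection (sref sref_apply bref bref_bref bref_apply bref_add mref mref_mref Φ Φ_r_inl Φ_r_inr Φ_s_inl Φ_s_inr
  reflSign_mul_self axisReflect_zsmul)
open Summit.QuantumFields.BalabanUV.Beta.TameKernelCalculus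
open Summit.QuantumFields.BalabanUV.Beta.ChartConjugation (conjV conjW conjW₁ conjW₂)
open Summit.QuantumFields.BalabanUV.Beta.BorderedHessian (diagK)
open Summit.QuantumFields.BalabanUV.Beta.E3LevelOneReflection (refK_add refK_smul refK_sub refK_Φ_refK_Φ Φ_r_r biLoc_refK_Φ)
open Summit.QuantumFields.BalabanUV.Beta.SecondOrderBorderGauge
open Summit.QuantumFields.BalabanUV.Beta.SecondOrderBorderCocycle
open Summit.QuantumFields.BalabanUV.Beta.VertexSandwichTransport (l1_sref_bref_sub_le)

namespace Summit.QuantumFields.BalabanUV.Beta.SecondOrderBorderClassKit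

noncomputable section

variable {d : ℕ}

/-! ## §1 Geometry of the leg maps -/

/-- [folklore] Reflecting two bond base points changes their `ℓ¹`-separation by at most `2`. -/
theorem l1_sub_le_l1_bref_sub_bref (α κ κ' : Fin (d + 1)) (u u' : Fin (d + 1) → ℤ) :
    l1 (u' - u) ≤ l1 (bref α κ' u' - bref α κ u) + 2 := by
  have key : ∀ i, |(((u' - u) i : ℤ) : ℝ)| ≤ |(((bref α κ' u' - bref α κ u) i : ℤ) : ℝ)| + if i = α then 2 else 0 := by
    intro i
    rw [Pi.sub_apply, Pi.sub_apply, bref_apply, bref_apply]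
    by_cases hi : i = α
    · simp only [hi, if_true]
      have h1 : |(((if κ' = α then (1 : ℤ) else 0) : ℤ) : ℝ) - (((if κ = α then (1 : ℤ) else 0) : ℤ) : ℝ)| ≤ 2 := by
        split_ifs <;> norm_num
      have e : (((u' α - u α : ℤ)) : ℝ) = -((((-1 - u' α - (if κ' = α then 1 else 0)) - (-1 - u α - (if κ = α then 1 else 0)) : ℤ) : ℝ)) -
          ((((if κ' = α then (1 : ℤ) else 0) : ℤ) : ℝ) - (((if κ = α then (1 : ℤ) else 0) : ℤ) : ℝ)) := by
        push_cast; ring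
      rw [e]
      exact (abs_sub _ _).trans (by rw [abs_neg]; linarith)
    · simp [hi]
  calc l1 (u' - u) = ∑ i, |(((u' - u) i : ℤ) : ℝ)| := rfl
    _ ≤ ∑ i, (|(((bref α κ' u' - bref α κ u) i : ℤ) : ℝ)| + if i = α then 2 else 0) := Finset.sum_le_sum fun i _ => key i
    _ = l1 (bref α κ' u' - bref α κ u) + 2 := by rw [Finset.sum_add_distrib, Finset.sum_ite_eq' Finset.univ α]; simp [l1]

/-- [folklore] The multiplier-leg map is affine with linear part `axisReflect`. -/
theorem mref_add (N : ℕ) (α κ : Fin (d + 1)) (x v : Fin (d + 1) → ℤ) : mref N α κ (x + v) = mref N α κ x + axisReflect α v := by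
  funext i
  simp only [ResolventReflection.mref, Pi.add_apply, axisReflect_apply]
  by_cases hi : i = α
  · simp [hi]; ring
  · simp [hi]

/-- [folklore] Every leg map of `Φ N α` is affine with linear part `axisReflect α`. -/
theorem Φ_r_add (N : ℕ) (α : Fin (d + 1)) (a : Fib d) (x v : Fin (d + 1) → ℤ) :
    (Φ (d := d) N α).r a (x + v) = (Φ (d := d) N α).r a x + axisReflect α v := by
  cases a with
  | inl κ => rw [Φ_r_inl, Φ_r_inl, bref_add]
  | inr κ => rw [Φ_r_inr, Φ_r_inr, mref_add]

/-- [folklore] `axisReflect` commutes with negation. -/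
theorem axisReflect_neg (α : Fin (d + 1)) (v : Fin (d + 1) → ℤ) : axisReflect α (-v) = -axisReflect α v := by
  funext i; by_cases hi : i = α <;> simp [hi]

/-- [folklore] **RELABELLING A KERNEL SHIFTED BY THE REFLECTED VECTOR = SHIFTING THE RELABELLED KERNEL.** -/
theorem refK_shiftK (N : ℕ) (α : Fin (d + 1)) (v : Fin (d + 1) → ℤ) (K : MKer (d + 1) (Fib d)) :
    refK (Φ (d := d) N α) (shiftK (axisReflect α v) K) = shiftK v (refK (Φ (d := d) N α) K) := by
  funext x z a b
  simp only [refK_apply, ExpKernelCalculus.shiftK, Φ_r_add]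

/-- [folklore] `|ε_κ| = 1`. -/
theorem abs_reflSign (α κ : Fin (d + 1)) : |reflSign α κ| = 1 := by
  rcases mul_self_eq_one_iff.mp (reflSign_mul_self α κ) with h | h <;> simp [h]

/-! ## §2 The `LocStencil₂` class under `actB`, `stepB`, `bdB` -/

/-- [folklore] **`actB` PRESERVES `LocStencil₂`** (blocking `N ≥ 1`, rate `δ ≥ 0`; constant `|C|·e^{(4N+4)δ}`). -/
theorem locStencil₂_actB {N : ℕ} (hN : 1 ≤ N) (α : Fin (d + 1))
    {F : Fin (d + 1) → (Fin (d + 1) → ℤ) → Fin (d + 1) → (Fin (d + 1) → ℤ) → MKer (d + 1) (Fib d)} {C δ : ℝ}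
    (h : LocStencil₂ F C δ) (hδ : 0 ≤ δ) : LocStencil₂ (actB N α F) (|C| * Real.exp (δ * (4 * N) + 4 * δ)) δ := by
  intro κ u κ' u'
  have h0 := h κ (bref α κ u) κ' (bref α κ' u')
  have h1 := biLoc_refK_Φ (d := d) (N := N) hN h0 hδ α
  have h2 := biLoc_recentre h1 hδ u u
  have h3 := biLoc_smul h2 (reflSign α κ * reflSign α κ')
  have hb1 := l1_sref_bref_sub_le α κ u
  have hb2 := l1_sub_le_l1_bref_sub_bref α κ κ' u u'
  refine biLoc_weaken h3 ?_ le_rfl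
  rw [abs_mul, abs_reflSign, abs_reflSign, one_mul, one_mul, abs_mul, Real.abs_exp]
  have hC : 0 ≤ |C| := abs_nonneg C
  calc |C| * Real.exp (-δ * l1 (bref α κ' u' - bref α κ u)) * Real.exp (δ * (4 * N)) *
        Real.exp (δ * (l1 (sref α (bref α κ u) - u) + l1 (sref α (bref α κ u) - u)))
      = |C| * Real.exp (-δ * l1 (bref α κ' u' - bref α κ u) + δ * (4 * N) +
          δ * (l1 (sref α (bref α κ u) - u) + l1 (sref α (bref α κ u) - u))) := by rw [Real.exp_add, Real.exp_add]; ring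
    _ ≤ |C| * Real.exp (δ * (4 * N) + 4 * δ + -δ * l1 (u' - u)) :=
        mul_le_mul_of_nonneg_left (Real.exp_le_exp.2 (by nlinarith)) hC
    _ = |C| * Real.exp (δ * (4 * N) + 4 * δ) * Real.exp (-δ * l1 (u' - u)) := by rw [Real.exp_add]; ring

/-- [folklore] **`stepB` PRESERVES `LocStencil₂`** (same rate). -/
theorem locStencil₂_stepB {N : ℕ} (hN : 1 ≤ N) (α : Fin (d + 1))
    {D T : Fin (d + 1) → (Fin (d + 1) → ℤ) → Fin (d + 1) → (Fin (d + 1) → ℤ) → MKer (d + 1) (Fib d)} {CD CT δ : ℝ}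
    (hD : LocStencil₂ D CD δ) (hT : LocStencil₂ T CT δ) (hδ : 0 ≤ δ) :
    LocStencil₂ (stepB N α D T) (|(1 / 2 : ℝ)| * (CT + |CT| * Real.exp (δ * (4 * N) + 4 * δ)) + |(-(1 / 2 : ℝ))| * CD) δ := by
  have hA := locStencil₂_actB hN α hT hδ
  have h1 := locStencil₂_smul' (1 / 2 : ℝ) (locStencil₂_add' hT hA)
  have h2 := locStencil₂_smul' (-(1 / 2 : ℝ)) hD
  have h3 := locStencil₂_add' h1 h2
  intro κ u κ' u'
  have e : stepB N α D T κ u κ' u' = (1 / 2 : ℝ) • (T κ u κ' u' + actB N α T κ u κ' u') + (-(1 / 2 : ℝ)) • D κ u κ' u' := by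
    simp only [stepB, Pi.sub_apply, Pi.add_apply, Pi.smul_apply, neg_smul, sub_eq_add_neg]
  rw [e]
  exact h3 κ u κ' u'

/-- [folklore] **`bdB` PRESERVES `LocStencil₂`** (entries are kept or zeroed). -/
theorem locStencil₂_bdB {F : Fin (d + 1) → (Fin (d + 1) → ℤ) → Fin (d + 1) → (Fin (d + 1) → ℤ) → MKer (d + 1) (Fib d)} {C δ : ℝ}
    (h : LocStencil₂ F C δ) : LocStencil₂ (bdB F) C δ := by
  intro κ u κ' u' x z a b
  have h0 := h κ u κ' u' x z a b
  have hnn : 0 ≤ C * Real.exp (-δ * l1 (u' - u)) * Real.exp (-δ * (l1 (x - u) + l1 (z - u))) := (abs_nonneg _).trans h0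
  rcases a with β | m <;> rcases b with β' | m'
  · rw [bdB_inl_inl, abs_zero]; exact hnn
  · rw [bdB_inl_inr]; exact h0
  · rw [bdB_inr_inl]; exact h0
  · rw [bdB_inr_inr, abs_zero]; exact hnn

/-! ## §3 Block-translation covariance under `actB`, `stepB`, `bdB` -/

/-- [folklore] **`actB` PRESERVES BLOCK-TRANSLATION COVARIANCE** (same blocking `N` for the action and the translations). -/
theorem translate_actB {N : ℕ} (α : Fin (d + 1))
    {F : Fin (d + 1) → (Fin (d + 1) → ℤ) → Fin (d + 1) → (Fin (d + 1) → ℤ) → MKer (d + 1) (Fib d)}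
    (hF : ∀ (κ : Fin (d + 1)) (u : Fin (d + 1) → ℤ) (κ' : Fin (d + 1)) (u' t : Fin (d + 1) → ℤ),
      F κ (u + (N : ℤ) • t) κ' (u' + (N : ℤ) • t) = shiftK (-((N : ℤ) • t)) (F κ u κ' u'))
    (κ : Fin (d + 1)) (u : Fin (d + 1) → ℤ) (κ' : Fin (d + 1)) (u' t : Fin (d + 1) → ℤ) :
    actB N α F κ (u + (N : ℤ) • t) κ' (u' + (N : ℤ) • t) = shiftK (-((N : ℤ) • t)) (actB N α F κ u κ' u') := by
  show (reflSign α κ * reflSign α κ') • refK (Φ (d := d) N α) (F κ (bref α κ (u + (N : ℤ) • t)) κ' (bref α κ' (u' + (N : ℤ) • t))) =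
    shiftK (-((N : ℤ) • t)) ((reflSign α κ * reflSign α κ') • refK (Φ (d := d) N α) (F κ (bref α κ u) κ' (bref α κ' u')))
  rw [bref_add, bref_add, axisReflect_zsmul, hF, show -((N : ℤ) • axisReflect α t) = axisReflect α (-((N : ℤ) • t)) by
    rw [axisReflect_neg, axisReflect_zsmul], refK_shiftK]
  rfl

/-- [folklore] **`stepB` PRESERVES BLOCK-TRANSLATION COVARIANCE.** -/
theorem translate_stepB {N : ℕ} (α : Fin (d + 1))
    {D T : Fin (d + 1) → (Fin (d + 1) → ℤ) → Fin (d + 1) → (Fin (d + 1) → ℤ) → MKer (d + 1) (Fib d)}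
    (hD : ∀ (κ : Fin (d + 1)) (u : Fin (d + 1) → ℤ) (κ' : Fin (d + 1)) (u' t : Fin (d + 1) → ℤ),
      D κ (u + (N : ℤ) • t) κ' (u' + (N : ℤ) • t) = shiftK (-((N : ℤ) • t)) (D κ u κ' u'))
    (hT : ∀ (κ : Fin (d + 1)) (u : Fin (d + 1) → ℤ) (κ' : Fin (d + 1)) (u' t : Fin (d + 1) → ℤ),
      T κ (u + (N : ℤ) • t) κ' (u' + (N : ℤ) • t) = shiftK (-((N : ℤ) • t)) (T κ u κ' u'))
    (κ : Fin (d + 1)) (u : Fin (d + 1) → ℤ) (κ' : Fin (d + 1)) (u' t : Fin (d + 1) → ℤ) :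
    stepB N α D T κ (u + (N : ℤ) • t) κ' (u' + (N : ℤ) • t) = shiftK (-((N : ℤ) • t)) (stepB N α D T κ u κ' u') := by
  funext x z a b
  simp only [stepB, Pi.sub_apply, Pi.add_apply, Pi.smul_apply, smul_eq_mul, ExpKernelCalculus.shiftK, hD, hT, translate_actB α hT]

/-- [folklore] **`bdB` PRESERVES BLOCK-TRANSLATION COVARIANCE.** -/
theorem translate_bdB {N : ℕ} {F : Fin (d + 1) → (Fin (d + 1) → ℤ) → Fin (d + 1) → (Fin (d + 1) → ℤ) → MKer (d + 1) (Fib d)}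
    (hF : ∀ (κ : Fin (d + 1)) (u : Fin (d + 1) → ℤ) (κ' : Fin (d + 1)) (u' t : Fin (d + 1) → ℤ),
      F κ (u + (N : ℤ) • t) κ' (u' + (N : ℤ) • t) = shiftK (-((N : ℤ) • t)) (F κ u κ' u'))
    (κ : Fin (d + 1)) (u : Fin (d + 1) → ℤ) (κ' : Fin (d + 1)) (u' t : Fin (d + 1) → ℤ) :
    bdB F κ (u + (N : ℤ) • t) κ' (u' + (N : ℤ) • t) = shiftK (-((N : ℤ) • t)) (bdB F κ u κ' u') := by
  funext x z a b
  rcases a with β | m <;> rcases b with β' | m' <;>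
    simp only [bdB_inl_inl, bdB_inl_inr, bdB_inr_inl, bdB_inr_inr, ExpKernelCalculus.shiftK, hF]

/-! ## §4 `LocStencil₂` of a canonical contact from the classes of its letters -/

section Products

variable {A B : MKer (d + 1) (Fib d)} {u u' : Fin (d + 1) → ℤ} {CA CB δ : ℝ}

/-- [folklore] **LEFT-FAR PRODUCT**: `A` bi-localised at `u′`, `B` at `u` ⇒ `A ∘ B` bi-localised at `u` with constant decaying in `|u′ − u|`
(rate `δ/4`). -/
theorem biLoc_comp_far_left (hA : BiLoc A u' u' CA δ) (hB : BiLoc B u u CB δ) (hδ : 0 < δ) :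
    BiLoc (comp A B) u u ((Fintype.card (Fib d) : ℝ) * (CA * CB) * Zl (d + 1) (δ / 2) * Real.exp (-(δ / 4) * l1 (u' - u))) (δ / 4) := by
  have hCA : 0 ≤ CA := hA.nonneg (Sum.inl 0)
  have hCB : 0 ≤ CB := hB.nonneg (Sum.inl 0)
  have h1 := biLoc_comp_biLoc hA hB hδ
  have hK : 0 ≤ (Fintype.card (Fib d) : ℝ) * (CA * CB) * Zl (d + 1) (δ / 2) :=
    mul_nonneg (mul_nonneg (Nat.cast_nonneg _) (mul_nonneg hCA hCB)) (Zl_pos (by positivity)).le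
  have el : l1 (u - u') = l1 (u' - u) := by rw [← OneStepKernelFamily.l1_neg_eq (u - u'), neg_sub]
  have hK1 : 0 ≤ (Fintype.card (Fib d) : ℝ) * (CA * CB) * Zl (d + 1) (δ / 2) * Real.exp (-(δ / 4) * l1 (u' - u)) :=
    mul_nonneg hK (Real.exp_pos _).le
  have h2 : BiLoc (comp A B) u' u
      ((Fintype.card (Fib d) : ℝ) * (CA * CB) * Zl (d + 1) (δ / 2) * Real.exp (-(δ / 4) * l1 (u' - u)) *
        Real.exp (-(δ / 4) * l1 (u - u'))) (δ / 4) := by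
    refine biLoc_mono (biLoc_weaken h1 (le_of_eq ?_) le_rfl) (mul_nonneg hK1 (Real.exp_pos _).le) (by linarith)
    rw [el, show Real.exp (-(δ / 2) * l1 (u' - u)) = Real.exp (-(δ / 4) * l1 (u' - u)) * Real.exp (-(δ / 4) * l1 (u' - u)) by
      rw [← Real.exp_add]; ring_nf]
    ring
  exact biLoc_recenter_left h2 hK1 (by positivity) le_rfl

/-- [folklore] **RIGHT-FAR PRODUCT**: `A` bi-localised at `u`, `B` at `u′` ⇒ `A ∘ B` bi-localised at `u` (rate `δ/4`). -/
theorem biLoc_comp_far_right (hA : BiLoc A u u CA δ) (hB : BiLoc B u' u' CB δ) (hδ : 0 < δ) :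
    BiLoc (comp A B) u u ((Fintype.card (Fib d) : ℝ) * (CA * CB) * Zl (d + 1) (δ / 2) * Real.exp (-(δ / 4) * l1 (u' - u))) (δ / 4) := by
  have hCA : 0 ≤ CA := hA.nonneg (Sum.inl 0)
  have hCB : 0 ≤ CB := hB.nonneg (Sum.inl 0)
  have h1 := biLoc_comp_biLoc hA hB hδ
  have hK : 0 ≤ (Fintype.card (Fib d) : ℝ) * (CA * CB) * Zl (d + 1) (δ / 2) :=
    mul_nonneg (mul_nonneg (Nat.cast_nonneg _) (mul_nonneg hCA hCB)) (Zl_pos (by positivity)).le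
  have el : l1 (u - u') = l1 (u' - u) := by rw [← OneStepKernelFamily.l1_neg_eq (u - u'), neg_sub]
  have hK1 : 0 ≤ (Fintype.card (Fib d) : ℝ) * (CA * CB) * Zl (d + 1) (δ / 2) * Real.exp (-(δ / 4) * l1 (u' - u)) :=
    mul_nonneg hK (Real.exp_pos _).le
  have h2 : BiLoc (comp A B) u u'
      ((Fintype.card (Fib d) : ℝ) * (CA * CB) * Zl (d + 1) (δ / 2) * Real.exp (-(δ / 4) * l1 (u' - u)) *
        Real.exp (-(δ / 4) * l1 (u - u'))) (δ / 4) := by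
    refine biLoc_mono (biLoc_weaken h1 (le_of_eq ?_) le_rfl) (mul_nonneg hK1 (Real.exp_pos _).le) (by linarith)
    rw [el, show Real.exp (-(δ / 2) * l1 (u' - u)) = Real.exp (-(δ / 4) * l1 (u' - u)) * Real.exp (-(δ / 4) * l1 (u' - u)) by
      rw [← Real.exp_add]; ring_nf]
    ring
  exact biLoc_recenter_right h2 hK1 (by positivity) le_rfl


/-- [folklore] Adding two bounds with a common exponential factor. -/
theorem biLoc_add' {K L : MKer (d + 1) (Fib d)} {p q : Fin (d + 1) → ℤ} {C₁ C₂ E δ : ℝ} (h₁ : BiLoc K p q (C₁ * E) δ)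
    (h₂ : BiLoc L p q (C₂ * E) δ) : BiLoc (K + L) p q ((C₁ + C₂) * E) δ := by
  have h := biLoc_add h₁ h₂; rwa [← add_mul] at h

/-- [folklore] Subtracting two bounds with a common exponential factor. -/
theorem biLoc_sub' {K L : MKer (d + 1) (Fib d)} {p q : Fin (d + 1) → ℤ} {C₁ C₂ E δ : ℝ} (h₁ : BiLoc K p q (C₁ * E) δ)
    (h₂ : BiLoc L p q (C₂ * E) δ) : BiLoc (K - L) p q ((C₁ + C₂) * E) δ := by
  have h := biLoc_sub h₁ h₂; rwa [← add_mul] at h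

/-- [folklore] From rate `δ/4` with an `e^{−(δ/4)|u′−u|}` constant to rate `δ/8` with an `e^{−(δ/8)|u′−u|}` constant. -/
theorem biLoc_quarter_to_eighth {K : MKer (d + 1) (Fib d)} {Kc δ : ℝ} (hK : 0 ≤ Kc) (hδ : 0 ≤ δ)
    (h : BiLoc K u u (Kc * Real.exp (-(δ / 4) * l1 (u' - u))) (δ / 4)) : BiLoc K u u (Kc * Real.exp (-(δ / 8) * l1 (u' - u))) (δ / 8) :=
  biLoc_weaken h (mul_le_mul_of_nonneg_left (Real.exp_le_exp.2 (by nlinarith [l1_nonneg (u' - u)])) hK) (by linarith)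

/-- [folklore] Re-associating a `comp`-constant `card·((Kc·e)·C)·Z` to `(card·Kc·C·Z)·e′` with a weaker exponential `e ≤ e′`. -/
theorem biLoc_constant_pull {K : MKer (d + 1) (Fib d)} {Kc C Z e e' δ : ℝ} (hK : 0 ≤ Kc) (hC : 0 ≤ C) (hZ : 0 ≤ Z) (he : e ≤ e')
    (h : BiLoc K u u ((Fintype.card (Fib d) : ℝ) * ((Kc * e) * C) * Z) δ) :
    BiLoc K u u (((Fintype.card (Fib d) : ℝ) * (Kc * C) * Z) * e') δ := by
  refine biLoc_weaken h ?_ le_rfl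
  calc (Fintype.card (Fib d) : ℝ) * ((Kc * e) * C) * Z = ((Fintype.card (Fib d) : ℝ) * (Kc * C) * Z) * e := by ring
    _ ≤ ((Fintype.card (Fib d) : ℝ) * (Kc * C) * Z) * e' := mul_le_mul_of_nonneg_left he (by positivity)

/-- [folklore] The same with the exponential on the right factor: `card·(C·(Kc·e))·Z`. -/
theorem biLoc_constant_pull' {K : MKer (d + 1) (Fib d)} {Kc C Z e e' δ : ℝ} (hK : 0 ≤ Kc) (hC : 0 ≤ C) (hZ : 0 ≤ Z) (he : e ≤ e')
    (h : BiLoc K u u ((Fintype.card (Fib d) : ℝ) * (C * (Kc * e)) * Z) δ) :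
    BiLoc K u u (((Fintype.card (Fib d) : ℝ) * (Kc * C) * Z) * e') δ := by
  refine biLoc_weaken h ?_ le_rfl
  calc (Fintype.card (Fib d) : ℝ) * (C * (Kc * e)) * Z = ((Fintype.card (Fib d) : ℝ) * (Kc * C) * Z) * e := by ring
    _ ≤ ((Fintype.card (Fib d) : ℝ) * (Kc * C) * Z) * e' := mul_le_mul_of_nonneg_left he (by positivity)

/-- [folklore] **`LocStencil₂` OF THE CANONICAL CONTACT FAMILY FROM THE CLASSES OF ITS LETTERS** (one rate `δ > 0` in, rate `δ/8` out): for
a decaying `𝕄`, local stencil families `S`, `X` and a `LocStencil₂` family `X₂`,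
`κ u κ′ u′ ↦ conjW 𝕄 (S κ u) (S κ′ u′) (X κ u) (X κ′ u′) (X₂ κ u κ′ u′)` is `LocStencil₂` (explicit, if long, constant). -/
theorem locStencil₂_conjW {𝕄 : MKer (d + 1) (Fib d)} {S X : Fin (d + 1) → (Fin (d + 1) → ℤ) → MKer (d + 1) (Fib d)}
    {X₂ : Fin (d + 1) → (Fin (d + 1) → ℤ) → Fin (d + 1) → (Fin (d + 1) → ℤ) → MKer (d + 1) (Fib d)} {C𝕄 Cs Cx C2 δ : ℝ}
    (h𝕄 : Decays 𝕄 C𝕄 δ) (hS : LocStencil S Cs δ) (hX : LocStencil X Cx δ) (hX₂ : LocStencil₂ X₂ C2 δ) (hδ : 0 < δ) :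
    ∃ C : ℝ, LocStencil₂ (fun κ u κ' u' => conjW 𝕄 (S κ u) (S κ' u') (X κ u) (X κ' u') (X₂ κ u κ' u')) C (δ / 8) := by
  have hC𝕄 : 0 ≤ C𝕄 := h𝕄.nonneg (Sum.inl 0)
  have hCs : 0 ≤ Cs := (hS 0 0).nonneg (Sum.inl 0)
  have hCx : 0 ≤ Cx := (hX 0 0).nonneg (Sum.inl 0)
  have hC2 : 0 ≤ C2 := by
    have h := (hX₂ 0 0 0 0).nonneg (Sum.inl 0)
    simpa [l1] using h
  have hZ2 : 0 ≤ Zl (d + 1) (δ / 2) := (Zl_pos (by positivity)).le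
  have hZ4 : 0 ≤ Zl (d + 1) (δ / 2 - δ / 8) := (Zl_pos (by linarith)).le
  have hZ8 : 0 ≤ Zl (d + 1) (δ / 4 - δ / 8) := (Zl_pos (by linarith)).le
  have hZ1 : 0 ≤ Zl (d + 1) (δ - δ / 2) := (Zl_pos (by linarith)).le
  have hZ7 : 0 ≤ Zl (d + 1) (δ - δ / 8) := (Zl_pos (by linarith)).le
  have hZq : 0 ≤ Zl (d + 1) (δ / 2 / 2) := (Zl_pos (by positivity)).le
  have h𝕄4 : Decays 𝕄 C𝕄 (δ / 4) := decays_mono h𝕄 hC𝕄 le_rfl (by linarith)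
  have hK : 0 ≤ (Fintype.card (Fib d) : ℝ) * (Cs * Cx) * Zl (d + 1) (δ / 2) := by positivity
  have hK' : 0 ≤ (Fintype.card (Fib d) : ℝ) * (Cx * Cs) * Zl (d + 1) (δ / 2) := by positivity
  have hKx : 0 ≤ (Fintype.card (Fib d) : ℝ) * (Cx * Cx) * Zl (d + 1) (δ / 2) := by positivity
  exact ⟨_, fun κ u κ' u' => by
    have hE4 : Real.exp (-(δ / 4) * l1 (u' - u)) ≤ Real.exp (-(δ / 8) * l1 (u' - u)) :=
      Real.exp_le_exp.2 (by nlinarith [l1_nonneg (u' - u)])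
    have hE1 : Real.exp (-δ * l1 (u' - u)) ≤ Real.exp (-(δ / 8) * l1 (u' - u)) :=
      Real.exp_le_exp.2 (by nlinarith [l1_nonneg (u' - u)])
    have hV : BiLoc (S κ u) u u Cs δ := hS κ u
    have hV' : BiLoc (S κ' u') u' u' Cs δ := hS κ' u'
    have hXu : BiLoc (X κ u) u u Cx δ := hX κ u
    have hXu' : BiLoc (X κ' u') u' u' Cx δ := hX κ' u'
    have hT₂ : BiLoc (X₂ κ u κ' u') u u (C2 * Real.exp (-δ * l1 (u' - u))) δ := hX₂ κ u κ' u'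
    -- conjW₁: the four far products
    have t1 := biLoc_quarter_to_eighth hK hδ.le (biLoc_comp_far_left hV' hXu hδ)
    have t2 := biLoc_quarter_to_eighth hK' hδ.le (biLoc_comp_far_right hXu hV' hδ)
    have t3 := biLoc_quarter_to_eighth hK hδ.le (biLoc_comp_far_right hV hXu' hδ)
    have t4 := biLoc_quarter_to_eighth hK' hδ.le (biLoc_comp_far_left hXu' hV hδ)
    -- conjW₂: (XX′)𝕄 and (X′X)𝕄
    have t5 := biLoc_constant_pull hKx hC𝕄 hZ8 hE4
      (biLoc_comp_right (biLoc_comp_far_right hXu hXu' hδ) h𝕄4 (by positivity) (by linarith))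
    have t6 := biLoc_constant_pull hKx hC𝕄 hZ8 hE4
      (biLoc_comp_right (biLoc_comp_far_left hXu' hXu hδ) h𝕄4 (by positivity) (by linarith))
    -- (X𝕄)X′ and (X′𝕄)X: first the sandwich factor at rate δ/2
    have hX𝕄 : BiLoc (comp (X κ u) 𝕄) u u ((Fintype.card (Fib d) : ℝ) * (Cx * C𝕄) * Zl (d + 1) (δ - δ / 2)) (δ / 2) :=
      biLoc_comp_right hXu h𝕄 (by positivity) (by linarith)
    have hX'𝕄 : BiLoc (comp (X κ' u') 𝕄) u' u' ((Fintype.card (Fib d) : ℝ) * (Cx * C𝕄) * Zl (d + 1) (δ - δ / 2)) (δ / 2) :=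
      biLoc_comp_right hXu' h𝕄 (by positivity) (by linarith)
    have hXu2 : BiLoc (X κ u) u u Cx (δ / 2) := biLoc_mono hXu hCx (by linarith)
    have hXu'2 : BiLoc (X κ' u') u' u' Cx (δ / 2) := biLoc_mono hXu' hCx (by linarith)
    have t7 := biLoc_comp_far_right hX𝕄 hXu'2 (by positivity : 0 < δ / 2)
    have t8 := biLoc_comp_far_left hX'𝕄 hXu2 (by positivity : 0 < δ / 2)
    rw [show δ / 2 / 4 = δ / 8 by ring] at t7 t8
    -- 𝕄X₂ and X₂𝕄
    have t9 := biLoc_constant_pull' hC2 hC𝕄 hZ7 hE1 (biLoc_comp_decays h𝕄 hT₂ (by positivity) (by linarith))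
    have t10 := biLoc_constant_pull hC2 hC𝕄 hZ7 hE1 (biLoc_comp_right hT₂ h𝕄 (by positivity) (by linarith))
    -- assemble along the definition of `conjW`
    show BiLoc (conjW₁ (S κ u) (S κ' u') (X κ u) (X κ' u') + conjW₂ 𝕄 (X κ u) (X κ' u') (X₂ κ u κ' u')) u u _ (δ / 8)
    exact biLoc_add' (biLoc_add' (biLoc_sub' t1 t2) (biLoc_sub' t3 t4))
      (biLoc_add' (biLoc_sub' (biLoc_add' t5 t6) (biLoc_add' t7 t8)) (biLoc_sub' t9 t10))⟩

end Products

end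

end Summit.QuantumFields.BalabanUV.Beta.SecondOrderBorderClassKit
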